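import Summits.Ventures.CertifiedQuantumChemistry.Rows.HubbardHalfFilledStrongCoupling
import HarnessLib

/-!
# Ventures/CertifiedQuantumChemistry — Rows/HubbardRingStrongCouplingLimit.lean: the strong-coupling
# constant of the half-filled Hubbard 4-ring, `lim_{U→∞} U·E₀(4;U) = −12` (sub-row T-K0-4, part 2 of 2)

HONEST FRAMING (verbatim): certified bounds for a stated model Hamiltonian in a stated basis; not a
claim about the real molecule beyond that model.

Seat ref/typer (`pub-qchem-typer`, gen 19), sub-row T-K0-4 (the lead's word HOME/INBOX L785 (D), RULINGS
TYP-46): THEOREMS ONLY (no `def`, no claim node, no row), zero compute, standard axioms. It is NOT a row,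
scores nothing and moves no `CERTIFIED.md` byte; it types the exact strong-coupling constant
`lim U·E₀(4;U) = −12` against which `HOME/STRUCTURE.md` §2 normalises the scaled relaxation gaps
`ĉ_X(4;U) = (U/4)(E₀ − OPT_X)` (with F-8 / F-5c's `lim U·OPT_DQG(4;U) = −8 − 4√2` it is the tree-side half of
`ĉ_DQG(4;∞) = √2 − 1`; a typed twin of the F-8 / F-5c objects is NOT in this file). Part 1
(`Rows/HubbardHalfFilledStrongCoupling.lean`) supplies, for any finite graph at half filling, Kato's
second-order limit `U · E_{(a,b)}(H(t,U)) → E_{K₀}(−H(t,0)²)`; this file computes the coefficient for the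
4-ring and assembles the limit for the cell's model object.

## What is proved

* §3 (the 4-ring, sector `(2,2)`): the finite exact computation **`E_{K₀}(−A²) = −12`**
  (`ring4_minEnergyOn_neg_sq`), `A = hamiltonian (ringGraph 4) 1 0`, `K₀` = the coordinate subspace of
  the six singly occupied `(2,2)` configurations. In Lieb's two-species coordinates of
  `Rows/HubbardRingKernel.lean` (`r4s2`, `r4K2`, `r4d22`; `W(Aφ) = K W + W K`,
  `Literature…TwoSpecies.coeffMatrix_hamiltonian_mulVec`) those configurations are the antidiagonal
  `(r4s2 i, r4s2 (rev i))` (`r4d22_eq_zero_iff`), `‖φ‖² = Σ_i |w_i|²` (`ring4_re_norm_eq`),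
  `‖Aφ‖² = Σ_{ij} |K_{i,rev j} w_{rev j} + w_i K_{rev i,j}|²` (`ring4_re_norm_mulVec_eq`)
  `= 2 Σ_{edges} |w_a + w_b|²` over the eight pairs `01, 04, 12, 13, 15, 24, 34, 45` (`ring4_realForm_eq`);
  LOWER half `‖Aφ‖² ≤ 12‖φ‖²` by the exact SOS
  `12|x|² − Q(x) = ½(4x₀−x₁−x₄)² + (7x₁−4x₂−4x₃−x₄−4x₅)²/14 + 4(6x₂−x₃−2x₄−x₅)²/21 + 4(5x₃−2x₄−x₅)²/15
  + 8(x₄−2x₅)²/5` (`ring4_realForm_le`; real and imaginary parts separately, `ring4_complexForm_le`);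
  UPPER half by the witness `w = (1,2,1,1,2,1)` (`ring4_witness`: `‖φ₀‖² = 12`, `‖Aφ₀‖² = 144`, integer
  arithmetic by `decide`).
* §4 **T-K0-4**: `tendsto_mul_energy_hubbardRingTV_four` —
  `Tendsto (fun U : ℚ => (U : ℝ) * (hubbardRingTV 4 1 U).energy 2 2) atTop (𝓝 (-12))`: for the TV-H
  integral file of the 4-ring (`t = 1`, `(pp|pp) = U ∈ ℚ`; `Model.energy _ 2 2 = E₀(H_F; N_α = N_β = 2)`
  = `sectorGroundEnergy`, the cell's QUANTITY K1) `U·E₀ → −12` along rational `U → ∞`; and the same on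
  the matrix and the joint sector, `tendsto_mul_minEnergyOn_szSector_hubbardRingTV_four`:
  `Tendsto (fun U : ℚ => (U : ℝ) * (hubbardRingTV 4 1 U).hamiltonian.minEnergyOn (szSector 4 0)) atTop
  (𝓝 (-12))` (T-06 `hubbardRingTV_hamiltonian_eq_one`; `szSector_two_mul_zero_eq`).

Not claimed: the coefficient for `L ≠ 4` (`−4·h(L)`, `h` the Heisenberg ring constant) is not computed;
nothing about any relaxation value `OPT_X`; no rate in `1/U` is exported.

References: T. Kato (1966) Ch. II §2.3 [Kato1966]; M. Takahashi (1999) §6.4 [Takahashi1999];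
E. H. Lieb, PRL 62 (1989) 1201, eq. (4) [LiebPRL1989]. Tree (REUSED): part 1; `TwoSpecies.re_sector_norm_eq` /
`coeffMatrix_hamiltonian_mulVec` / `ofSectorArray` / `IsSubsetEnum.sum_eq`, `Rows/HubbardRingKernel`
(`r4s2`, `r4K2`, `hoppingMatrix_r4s2`, `card_r4s2_inter`, `isSubsetEnum_r4s2`), `Rows/LiebSingletBridge`
(`hubbardRingTV_hamiltonian_eq_one`), `EigenvalueContinuation.exists_normalize`,
`minEnergyOn_mul_le_re_rayleigh`; Mathlib `Fin.sum_univ_six`, `tendsto_ratCast_atTop_iff`.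
Typer `pub-qchem-typer` (gen 19), 0 core-h.
-/

noncomputable section

namespace Summit.Ventures.CertifiedQuantumChemistry

open Matrix Finset Filter Topology
open Literature.MathematicalPhysics.QuantumLattice Literature.MathematicalPhysics.QuantumChemistry
open Literature.MathematicalPhysics.QuantumLattice.TwoSpecies LiebThm1
open Summit.Ventures.CertifiedQuantumChemistry.Hamiltonians

/-! ## §3 The half-filled 4-ring: the second-order coefficient `E_{K₀}(−A²) = −12`

`A = H(1, 0)` on the ring `0∼1∼2∼3∼0`, `K₀` = span of the six singly occupied `(2,2)` configurations.
In Lieb's two-species coordinates (`Rows/HubbardRingKernel.lean`: `r4s2`, `r4K2`, `r4d22`) these are the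
ANTIDIAGONAL pairs `(r4s2 i, r4s2 (rev i))` (`r4s2 (rev i) = (r4s2 i)ᶜ`); writing `w_i` for the six
coordinates, `‖φ‖² = Σ_i |w_i|²` and `‖Aφ‖² = Σ_{ij} |K_{i,rev j} w_{rev j} + w_i K_{rev i,j}|²
= 2 Σ_{edges ab} |w_a + w_b|²` over the eight pairs `01, 04, 12, 13, 15, 24, 34, 45`; the `6 × 6` matrix of
this form has spectrum `{0, 4, 4, 4, 8, 12}` (`= 4(1 − e)` over the `S_z = 0` levels `e ∈ {1, 0, 0, 0, −1, −2}` of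
the Heisenberg 4-ring `Σ_bonds S_x·S_y` — Anderson's superexchange `J = 4t²/U`; this identification is a
remark, not formalised), its top eigenvector is `(1,2,1,1,2,1)` and `12·𝟙 − form` is the exact sum of
squares recorded in `ring4_realForm_le`; only the top of the spectrum is certified below. -/

section Ring4

/-- In the enumeration `r4s2` the complementary `2`-subset of `r4s2 i` is `r4s2 (rev i)`: the double
occupancy `r4d22 i j = |r4s2 i ∩ r4s2 j|` vanishes exactly on the antidiagonal (kernel evaluation). -/
theorem r4d22_eq_zero_iff : ∀ i j : Fin 6, r4d22 i j = 0 ↔ j = i.rev := by decide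

/-- The explicit real quadratic form `Σ_{ij} (K_{i,rev j} x_{rev j} + x_i K_{rev i,j})²` of the 4-ring. -/
theorem ring4_realForm_eq (x : Fin 6 → ℝ) :
    ∑ i : Fin 6, ∑ j : Fin 6, ((r4K2 i j.rev : ℝ) * x j.rev + x i * (r4K2 i.rev j : ℝ)) ^ 2 =
      2 * ((x 0 + x 1) ^ 2 + (x 0 + x 4) ^ 2 + (x 1 + x 2) ^ 2 + (x 1 + x 3) ^ 2 + (x 1 + x 5) ^ 2
        + (x 2 + x 4) ^ 2 + (x 3 + x 4) ^ 2 + (x 4 + x 5) ^ 2) := by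
  simp only [Fin.sum_univ_six]
  have r0 : Fin.rev (0 : Fin 6) = 5 := rfl
  have r1 : Fin.rev (1 : Fin 6) = 4 := rfl
  have r2 : Fin.rev (2 : Fin 6) = 3 := rfl
  have r3 : Fin.rev (3 : Fin 6) = 2 := rfl
  have r4 : Fin.rev (4 : Fin 6) = 1 := rfl
  have r5 : Fin.rev (5 : Fin 6) = 0 := rfl
  simp only [r0, r1, r2, r3, r4, r5]
  simp [r4K2]
  ring

/-- **`‖Aφ‖² ≤ 12 ‖φ‖²` on `K₀`, real form**: `Σ_{ij} (K_{i,rev j} x_{rev j} + x_i K_{rev i,j})² ≤ 12 Σ_i x_i²`,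
by the exact SOS `12|x|² − Q(x) = ½(4x₀−x₁−x₄)² + (7x₁−4x₂−4x₃−x₄−4x₅)²/14 + 4(6x₂−x₃−2x₄−x₅)²/21
+ 4(5x₃−2x₄−x₅)²/15 + 8(x₄−2x₅)²/5`. -/
theorem ring4_realForm_le (x : Fin 6 → ℝ) :
    ∑ i : Fin 6, ∑ j : Fin 6, ((r4K2 i j.rev : ℝ) * x j.rev + x i * (r4K2 i.rev j : ℝ)) ^ 2 ≤
      12 * ∑ i : Fin 6, x i ^ 2 := by
  rw [ring4_realForm_eq, Fin.sum_univ_six]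
  have key : 12 * (x 0 ^ 2 + x 1 ^ 2 + x 2 ^ 2 + x 3 ^ 2 + x 4 ^ 2 + x 5 ^ 2) -
      2 * ((x 0 + x 1) ^ 2 + (x 0 + x 4) ^ 2 + (x 1 + x 2) ^ 2 + (x 1 + x 3) ^ 2 + (x 1 + x 5) ^ 2
        + (x 2 + x 4) ^ 2 + (x 3 + x 4) ^ 2 + (x 4 + x 5) ^ 2) =
      (1 / 2) * (4 * x 0 - x 1 - x 4) ^ 2 + (1 / 14) * (7 * x 1 - 4 * x 2 - 4 * x 3 - x 4 - 4 * x 5) ^ 2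
        + (4 / 21) * (6 * x 2 - x 3 - 2 * x 4 - x 5) ^ 2 + (4 / 15) * (5 * x 3 - 2 * x 4 - x 5) ^ 2
        + (8 / 5) * (x 4 - 2 * x 5) ^ 2 := by
    ring
  rw [← sub_nonneg, key]
  positivity

/-- The complex form splits into the real forms of the real and imaginary parts:
`Σ_{ij} |K_{i,rev j} w_{rev j} + w_i K_{rev i,j}|² ≤ 12 Σ_i |w_i|²` for every `w : Fin 6 → ℂ`. -/
theorem ring4_complexForm_le (w : Fin 6 → ℂ) :
    ∑ i : Fin 6, ∑ j : Fin 6, ‖(r4K2 i j.rev : ℂ) * w j.rev + w i * (r4K2 i.rev j : ℂ)‖ ^ 2 ≤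
      12 * ∑ i : Fin 6, ‖w i‖ ^ 2 := by
  have hre : ∀ i j : Fin 6, ‖(r4K2 i j.rev : ℂ) * w j.rev + w i * (r4K2 i.rev j : ℂ)‖ ^ 2 =
      ((r4K2 i j.rev : ℝ) * (w j.rev).re + (w i).re * (r4K2 i.rev j : ℝ)) ^ 2 +
        ((r4K2 i j.rev : ℝ) * (w j.rev).im + (w i).im * (r4K2 i.rev j : ℝ)) ^ 2 := by
    intro i j
    rw [Complex.sq_norm, Complex.normSq_apply]
    simp only [Complex.add_re, Complex.add_im, Complex.mul_re, Complex.mul_im, Complex.intCast_re,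
      Complex.intCast_im, mul_zero, zero_mul, sub_zero, add_zero]
    ring
  have hw : ∀ i : Fin 6, ‖w i‖ ^ 2 = (w i).re ^ 2 + (w i).im ^ 2 := fun i => by
    rw [Complex.sq_norm, Complex.normSq_apply]; ring
  simp only [hre, hw, Finset.sum_add_distrib, mul_add]
  exact add_le_add (ring4_realForm_le fun i => (w i).re) (ring4_realForm_le fun i => (w i).im)

variable {φ : Fock (Orb (Fin 4))}

/-- A vector supported on the singly occupied `(2,2)` configurations lies in the sector `(2,2)`. -/
theorem ring4_isInSector_of_supported
    (hφ : ∀ s : Finset (Orb (Fin 4)), ¬(((upPart s).card = 2 ∧ (downPart s).card = 2) ∧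
      (doublyOccupied s).card = 0) → φ s = 0) : IsInSector 2 2 φ :=
  fun s hs => hφ s fun h => hs h.1

/-- Its Lieb coordinates vanish off the antidiagonal of `r4s2 × r4s2`. -/
theorem ring4_coeffMatrix_eq_zero
    (hφ : ∀ s : Finset (Orb (Fin 4)), ¬(((upPart s).card = 2 ∧ (downPart s).card = 2) ∧
      (doublyOccupied s).card = 0) → φ s = 0) {i j : Fin 6} (hij : j ≠ i.rev) :
    coeffMatrix φ (r4s2 i) (r4s2 j) = 0 := by
  rw [coeffMatrix_apply, hφ _ ?_, mul_zero]
  rw [doublyOccupied, upPart_pairSet, downPart_pairSet, card_r4s2_inter]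
  exact fun h => hij ((r4d22_eq_zero_iff i j).1 h.2)

/-- `‖φ‖² = Σ_i |w_i|²` with `w_i = W(φ)(r4s2 i, r4s2 (rev i))`, for `φ` supported on the singly occupied
`(2,2)` configurations. -/
theorem ring4_re_norm_eq
    (hφ : ∀ s : Finset (Orb (Fin 4)), ¬(((upPart s).card = 2 ∧ (downPart s).card = 2) ∧
      (doublyOccupied s).card = 0) → φ s = 0) :
    (star φ ⬝ᵥ φ).re = ∑ i : Fin 6, ‖coeffMatrix φ (r4s2 i) (r4s2 i.rev)‖ ^ 2 := by
  rw [re_sector_norm_eq isSubsetEnum_r4s2 isSubsetEnum_r4s2 (ring4_isInSector_of_supported hφ),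
    normSqW]
  refine Finset.sum_congr rfl fun i _ => ?_
  rw [Finset.sum_eq_single_of_mem i.rev (Finset.mem_univ _)]
  intro j _ hj
  rw [ring4_coeffMatrix_eq_zero hφ hj, norm_zero, zero_pow two_ne_zero]

/-- `‖Aφ‖² = Σ_{ij} |K_{i,rev j} w_{rev j} + w_i K_{rev i,j}|²` (Lieb's `W(Aφ) = K W + W K` read on the
`(2,2)` sector of the 4-ring) for `φ` supported on the singly occupied configurations. -/
theorem ring4_re_norm_mulVec_eq
    (hφ : ∀ s : Finset (Orb (Fin 4)), ¬(((upPart s).card = 2 ∧ (downPart s).card = 2) ∧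
      (doublyOccupied s).card = 0) → φ s = 0) :
    (star (hamiltonian (ringGraph 4) 1 0 *ᵥ φ) ⬝ᵥ (hamiltonian (ringGraph 4) 1 0 *ᵥ φ)).re =
      ∑ i : Fin 6, ∑ j : Fin 6, ‖(r4K2 i j.rev : ℂ) * coeffMatrix φ (r4s2 j.rev) (r4s2 j.rev.rev) +
        coeffMatrix φ (r4s2 i) (r4s2 i.rev) * (r4K2 i.rev j : ℂ)‖ ^ 2 := by
  have hsec : IsInSector 2 2 φ := ring4_isInSector_of_supported hφ
  have hsecA : IsInSector 2 2 (hamiltonian (ringGraph 4) 1 0 *ᵥ φ) :=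
    (preservesSectors_hamiltonian (ringGraph 4) 1 0).isInSector_mulVec hsec
  have hW0 : ∀ α β : Finset (Fin 4), ¬(α.card = 2 ∧ β.card = 2) → coeffMatrix φ α β = 0 :=
    (isInSector_iff_coeffMatrix 2 2 φ).1 hsec
  have hcoord : ∀ i j : Fin 6, coeffMatrix (hamiltonian (ringGraph 4) 1 0 *ᵥ φ) (r4s2 i) (r4s2 j) =
      (r4K2 i j.rev : ℂ) * coeffMatrix φ (r4s2 j.rev) (r4s2 j.rev.rev) +
        coeffMatrix φ (r4s2 i) (r4s2 i.rev) * (r4K2 i.rev j : ℂ) := by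
    intro i j
    rw [coeffMatrix_hamiltonian_mulVec, Complex.ofReal_zero, zero_smul, add_zero, Matrix.add_apply,
      Matrix.mul_apply, Matrix.mul_apply]
    rw [isSubsetEnum_r4s2.sum_eq (fun γ => hoppingMatrix (ringGraph 4) 1 (r4s2 i) γ *
        coeffMatrix φ γ (r4s2 j)) (fun γ hγ => by rw [hW0 γ _ (fun h => hγ h.1), mul_zero]),
      isSubsetEnum_r4s2.sum_eq (fun β => coeffMatrix φ (r4s2 i) β *
        hoppingMatrix (ringGraph 4) 1 β (r4s2 j)) (fun β hβ => by rw [hW0 _ β (fun h => hβ h.2), zero_mul])]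
    simp only [hoppingMatrix_r4s2]
    congr 1
    · rw [Finset.sum_eq_single_of_mem j.rev (Finset.mem_univ _)]
      · rw [Fin.rev_rev]
      · intro i' _ hi'
        rw [ring4_coeffMatrix_eq_zero hφ (show j ≠ i'.rev from fun h => hi' (by rw [h, Fin.rev_rev])),
          mul_zero]
    · rw [Finset.sum_eq_single_of_mem i.rev (Finset.mem_univ _)]
      intro j' _ hj'
      rw [ring4_coeffMatrix_eq_zero hφ hj', zero_mul]
  rw [re_sector_norm_eq isSubsetEnum_r4s2 isSubsetEnum_r4s2 hsecA, normSqW]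
  simp only [hcoord]

/-- `Re⟨φ, (−A²) φ⟩ = −‖Aφ‖²` for a Hermitian `A`. -/
theorem re_star_dotProduct_neg_mul_self_mulVec {n : Type*} [Fintype n] {A : Matrix n n ℂ}
    (hA : A.IsHermitian) (ψ : n → ℂ) :
    (star ψ ⬝ᵥ (-(A * A)) *ᵥ ψ).re = -(star (A *ᵥ ψ) ⬝ᵥ (A *ᵥ ψ)).re := by
  rw [neg_mulVec, dotProduct_neg, Complex.neg_re, ← mulVec_mulVec, dotProduct_mulVec, star_mulVec, hA.eq]

/-- **LOWER half of `E_{K₀}(−A²) = −12`**: `‖Aφ‖² ≤ 12 ‖φ‖²` for every `φ` supported on the singly occupied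
`(2,2)` configurations of the 4-ring. -/
theorem ring4_re_norm_mulVec_le
    (hφ : ∀ s : Finset (Orb (Fin 4)), ¬(((upPart s).card = 2 ∧ (downPart s).card = 2) ∧
      (doublyOccupied s).card = 0) → φ s = 0) :
    (star (hamiltonian (ringGraph 4) 1 0 *ᵥ φ) ⬝ᵥ (hamiltonian (ringGraph 4) 1 0 *ᵥ φ)).re ≤
      12 * (star φ ⬝ᵥ φ).re := by
  rw [ring4_re_norm_mulVec_eq hφ, ring4_re_norm_eq hφ]
  exact ring4_complexForm_le fun k => coeffMatrix φ (r4s2 k) (r4s2 k.rev)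

/-- **UPPER half of `E_{K₀}(−A²) = −12`: the witness** — the antidiagonal array `(1,2,1,1,2,1)` (top
eigenvector of `P A² P`) gives a vector `φ₀` supported on the singly occupied `(2,2)` configurations with
`‖φ₀‖² = 12`, `‖Aφ₀‖² = 144` (integer arithmetic, kernel evaluation). -/
theorem ring4_witness : ∃ φ : Fock (Orb (Fin 4)),
    (∀ s : Finset (Orb (Fin 4)), ¬(((upPart s).card = 2 ∧ (downPart s).card = 2) ∧
      (doublyOccupied s).card = 0) → φ s = 0) ∧ (star φ ⬝ᵥ φ).re = 12 ∧
    (star (hamiltonian (ringGraph 4) 1 0 *ᵥ φ) ⬝ᵥ (hamiltonian (ringGraph 4) 1 0 *ᵥ φ)).re = 144 := by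
  set φ : Fock (Orb (Fin 4)) := ofSectorArray r4s2 r4s2
    (fun i j => if j = i.rev then (((![1, 2, 1, 1, 2, 1] : Fin 6 → ℤ) i : ℤ) : ℂ) else 0) with hφdef
  have hsupp : ∀ s : Finset (Orb (Fin 4)), ¬(((upPart s).card = 2 ∧ (downPart s).card = 2) ∧
      (doublyOccupied s).card = 0) → φ s = 0 := by
    intro s hs
    by_contra hne
    rw [hφdef, ofSectorArray, ofCoeffMatrix] at hne
    obtain ⟨i, -, hi⟩ := Finset.exists_ne_zero_of_sum_ne_zero (right_ne_zero_of_mul hne)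
    obtain ⟨j, -, hj⟩ := Finset.exists_ne_zero_of_sum_ne_zero hi
    by_cases hc : r4s2 i = upPart s ∧ r4s2 j = downPart s
    · rw [if_pos hc] at hj
      by_cases hji : j = i.rev
      · apply hs
        rw [doublyOccupied, ← hc.1, ← hc.2, isSubsetEnum_r4s2.card_eq, isSubsetEnum_r4s2.card_eq,
          card_r4s2_inter, (r4d22_eq_zero_iff i j).2 hji]
        exact ⟨⟨rfl, rfl⟩, rfl⟩
      · exact hj (if_neg hji)
    · exact hj (if_neg hc)
  have hw : ∀ i j : Fin 6, coeffMatrix φ (r4s2 i) (r4s2 j) =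
      if j = i.rev then (((![1, 2, 1, 1, 2, 1] : Fin 6 → ℤ) i : ℤ) : ℂ) else 0 :=
    fun i j => coeffMatrix_ofSectorArray isSubsetEnum_r4s2 isSubsetEnum_r4s2 _ i j
  refine ⟨φ, hsupp, ?_, ?_⟩
  · rw [ring4_re_norm_eq hsupp]
    simp only [hw, if_true, Complex.norm_intCast, sq_abs]
    have h12 : ((∑ i : Fin 6, (![1, 2, 1, 1, 2, 1] : Fin 6 → ℤ) i ^ 2 : ℤ) : ℝ) = 12 := by
      rw [show (∑ i : Fin 6, (![1, 2, 1, 1, 2, 1] : Fin 6 → ℤ) i ^ 2 : ℤ) = 12 from by decide]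
      norm_num
    simpa only [Int.cast_sum, Int.cast_pow] using h12
  · rw [ring4_re_norm_mulVec_eq hsupp]
    simp only [hw, Fin.rev_rev, if_true]
    have hcast : ∀ i j : Fin 6,
        ‖(r4K2 i j.rev : ℂ) * (((![1, 2, 1, 1, 2, 1] : Fin 6 → ℤ) j.rev : ℤ) : ℂ) +
          (((![1, 2, 1, 1, 2, 1] : Fin 6 → ℤ) i : ℤ) : ℂ) * (r4K2 i.rev j : ℂ)‖ ^ 2 =
        (((r4K2 i j.rev * (![1, 2, 1, 1, 2, 1] : Fin 6 → ℤ) j.rev +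
          (![1, 2, 1, 1, 2, 1] : Fin 6 → ℤ) i * r4K2 i.rev j) ^ 2 : ℤ) : ℝ) := by
      intro i j
      rw [← Int.cast_mul, ← Int.cast_mul, ← Int.cast_add, Complex.norm_intCast, sq_abs, Int.cast_pow]
    simp only [hcast]
    have h144 : ((∑ i : Fin 6, ∑ j : Fin 6, (r4K2 i j.rev * (![1, 2, 1, 1, 2, 1] : Fin 6 → ℤ) j.rev +
        (![1, 2, 1, 1, 2, 1] : Fin 6 → ℤ) i * r4K2 i.rev j) ^ 2 : ℤ) : ℝ) = 144 := by
      rw [show (∑ i : Fin 6, ∑ j : Fin 6, (r4K2 i j.rev * (![1, 2, 1, 1, 2, 1] : Fin 6 → ℤ) j.rev +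
        (![1, 2, 1, 1, 2, 1] : Fin 6 → ℤ) i * r4K2 i.rev j) ^ 2 : ℤ) = 144 from by decide]
      norm_num
    simpa only [Int.cast_sum] using h144

/-- **`E_{K₀}(−A²) = −12` for the half-filled 4-ring**: the second-order coefficient of Kato's reduction
(`K₀` = the coordinate subspace of the six singly occupied `(2,2)` configurations, entering through its
membership characterisation; `A = H(1,0)` the hopping Hamiltonian of the 4-ring). -/
theorem ring4_minEnergyOn_neg_sq {K₀ : Submodule ℂ (Fock (Orb (Fin 4)))}
    (hK₀ : ∀ ψ, ψ ∈ K₀ ↔ ∀ s : Finset (Orb (Fin 4)),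
      ¬(((upPart s).card = 2 ∧ (downPart s).card = 2) ∧ (doublyOccupied s).card = 0) → ψ s = 0) :
    (-(hamiltonian (ringGraph 4) 1 0 * hamiltonian (ringGraph 4) 1 0)).minEnergyOn K₀ = -12 := by
  have hA := hamiltonian_zero_isHermitian (ringGraph 4) 1
  obtain ⟨φ₀, hφ₀, hn, hAn⟩ := ring4_witness
  have hφ₀K : φ₀ ∈ K₀ := (hK₀ φ₀).2 hφ₀
  have hAA : (-(hamiltonian (ringGraph 4) 1 0 * hamiltonian (ringGraph 4) 1 0)).IsHermitian := by
    have h2 : (hamiltonian (ringGraph 4) 1 0 * hamiltonian (ringGraph 4) 1 0).IsHermitian := by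
      rw [IsHermitian, conjTranspose_mul, hA.eq]
    exact h2.neg
  refine le_antisymm ?_ ?_
  · -- Rayleigh–Ritz with the witness
    have h := minEnergyOn_mul_le_re_rayleigh hAA K₀ hφ₀K
    rw [re_star_dotProduct_neg_mul_self_mulVec hA, hn, hAn] at h
    linarith
  · -- `‖Aψ‖² ≤ 12` for every unit `ψ ∈ K₀`
    have hφ₀0 : φ₀ ≠ 0 := by
      intro h0
      rw [h0, dotProduct_zero, Complex.zero_re] at hn
      norm_num at hn
    obtain ⟨c, -, -, hc1⟩ := EigenvalueContinuation.exists_normalize hφ₀0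
    refine le_csInf ⟨_, _, K₀.smul_mem _ hφ₀K, hc1, rfl⟩ ?_
    rintro E ⟨ψ, hψK, hψ1, rfl⟩
    rw [re_star_dotProduct_neg_mul_self_mulVec hA]
    have hle := ring4_re_norm_mulVec_le ((hK₀ ψ).1 hψK)
    rw [hψ1, Complex.one_re, mul_one] at hle
    linarith

end Ring4

/-! ## §4 T-K0-4: the strong-coupling constant of the half-filled Hubbard 4-ring, `lim U·E₀(4;U) = −12` -/

section Main

/-- **T-K0-4.** For the TV-H integral file of the 4-site Hubbard ring (`hubbardRingTV 4 1 U`: `t = 1`,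
`(pp|pp) = U ∈ ℚ`) the cell's certified QUANTITY `Model.energy _ 2 2 = E₀(H_F; N_α = N_β = 2)` (the
half-filled `S_z = 0` sector) satisfies `U · E₀ → −12` as `U → ∞` along `ℚ`: the exact strong-coupling
constant against which `HOME/STRUCTURE.md` §2 normalises `ĉ_X(4;U)`. Kato's second-order reduction
(`Literature…StrongCouplingSecondOrderLimit`, vanishing first-order term, gap `δ = 1`) with the
coefficient `E_{K₀}(−A²) = −12` of §3. -/
theorem tendsto_mul_energy_hubbardRingTV_four :
    Tendsto (fun U : ℚ => (U : ℝ) * (hubbardRingTV 4 1 U).energy 2 2) atTop (𝓝 (-12)) := by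
  classical
  set Z : Finset (Finset (Orb (Fin 4))) := univ.filter fun s =>
    ((upPart s).card = 2 ∧ (downPart s).card = 2) ∧ (doublyOccupied s).card = 0 with hZ
  set K₀ : Submodule ℂ (Fock (Orb (Fin 4))) :=
    Submodule.pi ((Z : Set (Finset (Orb (Fin 4))))ᶜ) (fun _ => (⊥ : Submodule ℂ ℂ)) with hK₀def
  have hK₀ : ∀ ψ, ψ ∈ K₀ ↔ ∀ s : Finset (Orb (Fin 4)),
      ¬(((upPart s).card = 2 ∧ (downPart s).card = 2) ∧ (doublyOccupied s).card = 0) →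
        ψ s = 0 := by
    intro ψ
    rw [mem_pi_compl_bot_iff]
    simp only [hZ, Finset.mem_filter, Finset.mem_univ, true_and]
  have hne : ∃ s : Finset (Orb (Fin 4)),
      ((upPart s).card = 2 ∧ (downPart s).card = 2) ∧ (doublyOccupied s).card = 0 :=
    ⟨pairSet {0, 1} {2, 3}, by rw [doublyOccupied, upPart_pairSet, downPart_pairSet]; decide⟩
  have hgen := tendsto_mul_minEnergyOn_hamiltonian_halfFilled (ringGraph 4) 1 (a := 2) (b := 2)
    (by simp) hK₀ hne
  rw [ring4_minEnergyOn_neg_sq hK₀] at hgen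
  have h := hgen.comp (tendsto_ratCast_atTop_iff.2 tendsto_id)
  refine h.congr fun U => ?_
  simp only [Function.comp_apply, id_eq, Model.energy, sectorGroundEnergy_def,
    hubbardRingTV_hamiltonian_eq_one]

/-- The same limit spelled on the matrix and the joint sector as `HOME/STRUCTURE.md` §2 writes it:
`U · E_{szSector 4 0}(Model.hamiltonian (hubbardRingTV 4 1 U)) → −12` (`szSector (2·2) 0` is the `(2,2)`
sector, `szSector_two_mul_zero_eq`). -/
theorem tendsto_mul_minEnergyOn_szSector_hubbardRingTV_four :
    Tendsto (fun U : ℚ => (U : ℝ) * (hubbardRingTV 4 1 U).hamiltonian.minEnergyOn (szSector 4 0)) atTop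
      (𝓝 (-12)) := by
  refine tendsto_mul_energy_hubbardRingTV_four.congr fun U => ?_
  rw [Model.energy, sectorGroundEnergy_def, ← szSector_two_mul_zero_eq 2]

end Main

end Summit.Ventures.CertifiedQuantumChemistry

end
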